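import Summits.CriticalPhenomena.PercolationContinuityZ3.Theses.PercNearOneGluing
import Literature.Probability.Percolation.PercolationEvents
import HarnessLib.Audit
import Literature.Probability.LatticeModels.ProdBernoulliIndependence
import Summits.CriticalPhenomena.PercolationContinuityZ3.Theorems.PercNearOneGluingAdditiveGluingOneBond
import Summits.CriticalPhenomena.PercolationContinuityZ3.Theorems.PercNearOneGluingAdditiveGluingKnLemma3Mixed
import Summits.CriticalPhenomena.PercolationContinuityZ3.Theorems.PercNearOneGluingNearOneGluingPivotalityDomination

/-! # Shortening step (KN Conjecture 6) — reduction to a set-source exchange inequality, and the `x ∈ A` face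

Helpers for `stub_shorteningStep` of line `kn_shortening_induction` (crux stmt-CriticalPhenomena-4574,
Kozma–Nitzan arXiv:2401.12397 Conjecture 6, p. 34), found while working TTRL variant V2388.

Write `μ = prodBernoulli w`, `μ₁ = prodBernoulli (w[s(v,x) ↦ 1])` (the pair `{v, x}` contracted),
`V = {v, x}` and `{V ↔ z} = {v ↔ z} ∪ {x ↔ z}`.

* `shorteningStep_of_setSourceExchange` — for ANY relay set `A` and designated relay `a₀`, the
  conclusion of the shortening step, `μ₁(v ↔ A) · μ₁(a₀ ↔ b) ≤ μ₁(v ↔ b)`, follows from the single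
  uncontracted inequality
  `(S)  μ(a₀ ↔ b, V ↔ A, V ↮ a₀) ≤ μ(V ↔ b, V ↮ a₀)`
  ("set-source exchange at the designated relay").  Proof = the transport/Harris/event-algebra part of
  the landed `|A| ≤ 2` case (`stub_shorteningStep_var2415`), with the Lemma-3 step abstracted into the
  hypothesis: `μ₁` is the image of `μ` under `ω ↦ insert s(v,x) ω`; Harris for the increasing events
  `E = {V ↔ A}`, `K = {a₀ ↔ b} ∪ ({a₀ ↔ v} ∩ {x ↔ b}) ∪ ({a₀ ↔ x} ∩ {v ↔ b})`; and
  `E ∩ K ⊆ ({V ↔ b} ∩ {a₀ ↔ V}) ∪ ({a₀ ↔ b} ∩ {V ↔ A} ∩ {V ↮ a₀})`.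
  Equivalently, (S) says `P(o ↔ A, a₀ ↔ b) ≤ P(o ↔ b)` in the contracted graph with source `o = V`
  (between KN's pre-FKG inequality (41) and Conjecture 1); it needs no induction hypothesis.
* `shorteningStep_of_le_partner` / `shorteningStep_of_le_source` — the shortening step holds outright,
  for every relay set `A`, as soon as `μ(a₀ ↔ b) ≤ μ(x ↔ b)` or `μ(a₀ ↔ b) ≤ μ(v ↔ b)` (in particular on
  the face `x ∈ A` of Conjecture 6 with `a₀` the minimiser, and when `b ∈ {v, x}`): there (S) is
  Kozma–Nitzan Lemma 3 for the mixed-monotone event `{V ↮ a₀}` (`knLemma3Mixed`, from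
  van den Berg–Häggström–Kahn 2006 Thm 1.5) with `a₂ = x` (resp. `a₂ = v`).  What remains OPEN of
  the registered stub is therefore the regime `μ(v ↔ b) < μ(a₀ ↔ b)` and `μ(x ↔ b) < μ(a₀ ↔ b)`: the
  source and its glued partner are both less reliable than the least reliable relay.
No new definitions, no named facts. -/

namespace Summit.CriticalPhenomena.PercolationContinuityZ3.Theorems

open MeasureTheory Set Literature.Probability.LatticeModels Literature.Probability.Percolation
open scoped Classical BigOperators

/-- **Reduction of the shortening step to a set-source exchange inequality.**  For a weight function
`w` on the pairs of `Fin n`, vertices `v ≠ x`, any relay set `A`, target `b` and designated relay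
`a₀`: if `μ(a₀ ↔ b, V ↔ A, V ↮ a₀) ≤ μ(V ↔ b, V ↮ a₀)` in the UNcontracted measure
`μ = prodBernoulli w` (`V = {v, x}`), then in the contracted measure `μ₁ = prodBernoulli (w[s(v,x) ↦ 1])`
one has `μ₁(v ↔ A) · μ₁(a₀ ↔ b) ≤ μ₁(v ↔ b)` — the conclusion of Kozma–Nitzan's Conjecture 6
(arXiv:2401.12397 p. 34).  Transport along `ω ↦ insert s(v,x) ω`, Harris, event algebra. -/
theorem shorteningStep_of_setSourceExchange : ∀ (n : ℕ) (w : Sym2 (Fin n) → unitInterval) (A : Finset (Fin n)) (b v x a₀ : Fin n), v ≠ x → (prodBernoulli w).real (openConn a₀ b ∩ {ω | (∃ a ∈ A, (openGraph ω).Reachable v a ∨ (openGraph ω).Reachable x a) ∧ ¬ (openGraph ω).Reachable a₀ v ∧ ¬ (openGraph ω).Reachable a₀ x}) ≤ (prodBernoulli w).real ((openConn v b ∪ openConn x b) ∩ {ω | ¬ (openGraph ω).Reachable a₀ v ∧ ¬ (openGraph ω).Reachable a₀ x}) → (prodBernoulli (Function.update w s(v, x) 1)).real (⋃ a ∈ A,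 openConn v a) * (prodBernoulli (Function.update w s(v, x) 1)).real (openConn a₀ b) ≤ (prodBernoulli (Function.update w s(v, x) 1)).real (openConn v b) := by
  intro n w A b v x a₀ hvx hS
  -- every event is measurable on the finite configuration space
  have hmeas : ∀ S : Set (BondConfig (Fin n)), MeasurableSet S := fun S =>
    MeasurableSet.of_discrete
  -- transport along `ω ↦ insert s(v,x) ω`, whose image measure is the glued measure
  have hmi : Measurable fun ω : BondConfig (Fin n) => insert s(v, x) ω := by
    refine measurable_set_iff.2 fun i => ?_
    simp only [Set.mem_insert_iff]
    exact measurable_const.or (measurable_set_mem i)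
  have htrans : ∀ F : Set (BondConfig (Fin n)),
      (prodBernoulli (Function.update w s(v, x) 1)).real F =
        (prodBernoulli w).real ((fun ω : BondConfig (Fin n) => insert s(v, x) ω) ⁻¹' F) := by
    intro F
    rw [← goodStepEI_prodBernoulli_map_insert w s(v, x), map_measureReal_apply hmi (hmeas F)]
  -- the events of the uncontracted graph (`V = {v, x}`)
  set Fb : Set (BondConfig (Fin n)) := openConn v b ∪ openConn x b with hFb
  set E : Set (BondConfig (Fin n)) :=
    {ω | ∃ a ∈ A, (openGraph ω).Reachable v a ∨ (openGraph ω).Reachable x a} with hE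
  set K : Set (BondConfig (Fin n)) :=
    openConn a₀ b ∪ ((openConn a₀ v ∩ openConn x b) ∪ (openConn a₀ x ∩ openConn v b)) with hK
  set T : Set (BondConfig (Fin n)) := openConn a₀ v ∪ openConn a₀ x with hT
  set N : Set (BondConfig (Fin n)) :=
    {ω | ¬ (openGraph ω).Reachable a₀ v ∧ ¬ (openGraph ω).Reachable a₀ x} with hN
  set Q : Set (BondConfig (Fin n)) :=
    {ω | (∃ a ∈ A, (openGraph ω).Reachable v a ∨ (openGraph ω).Reachable x a) ∧
      ¬ (openGraph ω).Reachable a₀ v ∧ ¬ (openGraph ω).Reachable a₀ x} with hQ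
  -- (1) the three transports
  have hX : (prodBernoulli w).real Fb ≤
      (prodBernoulli (Function.update w s(v, x) 1)).real (openConn v b) := by
    rw [htrans]
    refine measureReal_mono (fun ω hω => ?_)
    rcases hω with h | h
    · exact (h : (openGraph ω).Reachable v b).mono (openGraph_mono (Set.subset_insert _ _))
    · exact pivDom_reachable_insert_of ω hvx h
  have hY : (prodBernoulli (Function.update w s(v, x) 1)).real (⋃ a ∈ A, openConn v a) ≤
      (prodBernoulli w).real E := by
    rw [htrans]
    refine measureReal_mono (fun ω hω => ?_)
    simp only [Set.mem_preimage, Set.mem_iUnion, exists_prop] at hω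
    obtain ⟨a, ha, h⟩ := hω
    refine ⟨a, ha, ?_⟩
    rcases pivDom_reachable_insert ω v x v a h with h1 | ⟨-, h1⟩ | ⟨-, h1⟩
    exacts [Or.inl h1, Or.inr h1, Or.inl h1]
  have hZ : (prodBernoulli (Function.update w s(v, x) 1)).real (openConn a₀ b) ≤
      (prodBernoulli w).real K := by
    rw [htrans]
    refine measureReal_mono (fun ω hω => ?_)
    rcases pivDom_reachable_insert ω v x a₀ b hω with h1 | ⟨h1, h2⟩ | ⟨h1, h2⟩
    exacts [Or.inl h1, Or.inr (Or.inl ⟨h1, h2⟩), Or.inr (Or.inr ⟨h1, h2⟩)]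
  -- (2) Harris for the increasing events `E`, `K`
  have hEup : IsUpperSet E := by
    intro ω ω' hle hω
    obtain ⟨a, ha, h⟩ := hω
    refine ⟨a, ha, ?_⟩
    rcases h with h | h
    · exact Or.inl (h.mono (openGraph_mono hle))
    · exact Or.inr (h.mono (openGraph_mono hle))
  have hKup : IsUpperSet K :=
    (isUpperSet_openConn a₀ b).union
      (((isUpperSet_openConn a₀ v).inter (isUpperSet_openConn x b)).union
        ((isUpperSet_openConn a₀ x).inter (isUpperSet_openConn v b)))
  have hHarris : (prodBernoulli w).real E * (prodBernoulli w).real K ≤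
      (prodBernoulli w).real (E ∩ K) :=
    prodBernoulli_harris w hEup hKup (hmeas _) (hmeas _)
  -- (3) event algebra
  have hsplit : E ∩ K ⊆ (Fb ∩ T) ∪ (openConn a₀ b ∩ Q) := by
    rintro ω ⟨hωE, hωK⟩
    by_cases hT' : ω ∈ T
    · left
      refine ⟨?_, hT'⟩
      rcases hωK with hab | ⟨_, hxb⟩ | ⟨_, hvb⟩
      · rcases hT' with hav | hax
        · exact Or.inl ((SimpleGraph.Reachable.symm hav).trans hab)
        · exact Or.inr ((SimpleGraph.Reachable.symm hax).trans hab)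
      · exact Or.inr hxb
      · exact Or.inl hvb
    · right
      have hav : ¬ (openGraph ω).Reachable a₀ v := fun h => hT' (Or.inl h)
      have hax : ¬ (openGraph ω).Reachable a₀ x := fun h => hT' (Or.inr h)
      refine ⟨?_, hωE, hav, hax⟩
      rcases hωK with hab | ⟨h, _⟩ | ⟨h, _⟩
      exacts [hab, absurd h hav, absurd h hax]
  have hNT : Fb ∩ N ⊆ Fb \ T := by
    rintro ω ⟨hFb', hv', hx'⟩
    refine ⟨hFb', ?_⟩
    rintro (h | h)
    · exact hv' h
    · exact hx' h
  -- (4) assemble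
  have hFsum : (prodBernoulli w).real (Fb ∩ T) + (prodBernoulli w).real (Fb \ T) =
      (prodBernoulli w).real Fb :=
    measureReal_inter_add_sdiff (hmeas T)
  have h1 : (prodBernoulli w).real (E ∩ K) ≤
      (prodBernoulli w).real (Fb ∩ T) + (prodBernoulli w).real (openConn a₀ b ∩ Q) :=
    (measureReal_mono hsplit).trans (measureReal_union_le _ _)
  have h2 : (prodBernoulli w).real (Fb ∩ N) ≤ (prodBernoulli w).real (Fb \ T) :=
    measureReal_mono hNT
  have h3 : (prodBernoulli w).real (openConn a₀ b ∩ Q) ≤ (prodBernoulli w).real (Fb ∩ N) := hS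
  calc (prodBernoulli (Function.update w s(v, x) 1)).real (⋃ a ∈ A, openConn v a) *
        (prodBernoulli (Function.update w s(v, x) 1)).real (openConn a₀ b)
      ≤ (prodBernoulli w).real E * (prodBernoulli w).real K :=
        mul_le_mul hY hZ measureReal_nonneg measureReal_nonneg
    _ ≤ (prodBernoulli w).real (E ∩ K) := hHarris
    _ ≤ (prodBernoulli w).real Fb := by linarith
    _ ≤ (prodBernoulli (Function.update w s(v, x) 1)).real (openConn v b) := hX

/-- **The shortening step when the glued partner is at least as reliable as the designated relay**
(covers the face `x ∈ A` of KN Conjecture 6 for every `|A|`, and `x = b`).  If `μ(a₀ ↔ b) ≤ μ(x ↔ b)`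
(e.g. `a₀` minimises `μ(· ↔ b)` on a relay set containing `x`), then for ANY relay set `A`
`μ₁(v ↔ A) · μ₁(a₀ ↔ b) ≤ μ₁(v ↔ b)` for `μ₁ = prodBernoulli (w[s(v,x) ↦ 1])`: the set-source
exchange inequality is then Kozma–Nitzan Lemma 3 for the mixed-monotone event `{V ↮ a₀}`
(`knLemma3Mixed` with `a₁ = a₀`, `a₂ = x`), since `{x ↔ b} ∩ {V ↮ a₀} ⊆ {V ↔ b} ∩ {V ↮ a₀}`. -/
theorem shorteningStep_of_le_partner : ∀ (n : ℕ) (w : Sym2 (Fin n) → unitInterval) (A : Finset (Fin n)) (b v x a₀ : Fin n), v ≠ x → (prodBernoulli w).real (openConn a₀ b) ≤ (prodBernoulli w).real (openConn x b) → (prodBernoulli (Function.update w s(v, x) 1)).real (⋃ a ∈ A, openConn v a) * (prodBernoulli (Function.update w s(v, x) 1)).real (openConn a₀ b) ≤ (prodBernoulli (Function.update w s(v, x) 1)).real (openConn v b) := by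
  intro n w A b v x a₀ hvx hmin
  refine shorteningStep_of_setSourceExchange n w A b v x a₀ hvx ?_
  set N : Set (BondConfig (Fin n)) :=
    {ω | ¬ (openGraph ω).Reachable a₀ v ∧ ¬ (openGraph ω).Reachable a₀ x} with hN
  -- `N = {V ↮ a₀}` is decreasing in the open edge cluster of `a₀` (and does not involve `C_x`)
  have hmixed : ∀ ω ω' : BondConfig (Fin n), ω ∈ N →
      openEdgeCluster ω x ⊆ openEdgeCluster ω' x →
        openEdgeCluster ω' a₀ ⊆ openEdgeCluster ω a₀ → ω' ∈ N := by
    rintro ω ω' ⟨hv', hx'⟩ - h1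
    have key : ∀ z, (openGraph ω').Reachable a₀ z → (openGraph ω).Reachable a₀ z := by
      intro z hz
      rcases (reachable_iff_exists_mem_openEdgeCluster ω' a₀ z).1 hz with rfl | ⟨e, he, hze⟩
      · exact SimpleGraph.Reachable.refl _
      · exact (reachable_iff_exists_mem_openEdgeCluster ω a₀ _).2 (Or.inr ⟨e, h1 he, hze⟩)
    exact ⟨fun h => hv' (key v h), fun h => hx' (key x h)⟩
  have hL3 : (prodBernoulli w).real (openConn a₀ b ∩ N) ≤
      (prodBernoulli w).real (openConn x b ∩ N) + 0 :=
    knLemma3Mixed n w a₀ x b N 0 hmixed le_rfl (by rw [add_zero]; exact hmin)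
  have hmono₁ : (prodBernoulli w).real (openConn a₀ b ∩
        {ω | (∃ a ∈ A, (openGraph ω).Reachable v a ∨ (openGraph ω).Reachable x a) ∧
          ¬ (openGraph ω).Reachable a₀ v ∧ ¬ (openGraph ω).Reachable a₀ x}) ≤
      (prodBernoulli w).real (openConn a₀ b ∩ N) :=
    measureReal_mono (fun ω ⟨hab, _, hv', hx'⟩ => ⟨hab, hv', hx'⟩) (measure_ne_top _ _)
  have hmono₂ : (prodBernoulli w).real (openConn x b ∩ N) ≤
      (prodBernoulli w).real ((openConn v b ∪ openConn x b) ∩ N) :=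
    measureReal_mono (fun ω ⟨hxb, hω⟩ => ⟨Or.inr hxb, hω⟩) (measure_ne_top _ _)
  linarith

/-- **Symmetric form: the source itself is at least as reliable as the designated relay.**  If
`μ(a₀ ↔ b) ≤ μ(v ↔ b)` then `μ₁(v ↔ A) · μ₁(a₀ ↔ b) ≤ μ₁(v ↔ b)` for `μ₁ = prodBernoulli (w[s(v,x) ↦ 1])`
and every relay set `A`: swap the roles of `v` and `x` in `shorteningStep_of_le_partner` (`s(x,v) = s(v,x)`,
and under the transport `ω ↦ insert s(v,x) ω` the vertices `v` and `x` have the same open cluster). -/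
theorem shorteningStep_of_le_source : ∀ (n : ℕ) (w : Sym2 (Fin n) → unitInterval) (A : Finset (Fin n)) (b v x a₀ : Fin n), v ≠ x → (prodBernoulli w).real (openConn a₀ b) ≤ (prodBernoulli w).real (openConn v b) → (prodBernoulli (Function.update w s(v, x) 1)).real (⋃ a ∈ A, openConn v a) * (prodBernoulli (Function.update w s(v, x) 1)).real (openConn a₀ b) ≤ (prodBernoulli (Function.update w s(v, x) 1)).real (openConn v b) := by
  intro n w A b v x a₀ hvx hmin
  have h := shorteningStep_of_le_partner n w A b x v a₀ hvx.symm hmin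
  rw [Sym2.eq_swap] at h
  -- under the glued measure, `v` and `x` have the same open cluster (transport along `insert s(v,x)`)
  have hmeas : ∀ S : Set (BondConfig (Fin n)), MeasurableSet S := fun S =>
    MeasurableSet.of_discrete
  have hmi : Measurable fun ω : BondConfig (Fin n) => insert s(v, x) ω := by
    refine measurable_set_iff.2 fun i => ?_
    simp only [Set.mem_insert_iff]
    exact measurable_const.or (measurable_set_mem i)
  have htrans : ∀ F : Set (BondConfig (Fin n)),
      (prodBernoulli (Function.update w s(v, x) 1)).real F =
        (prodBernoulli w).real ((fun ω : BondConfig (Fin n) => insert s(v, x) ω) ⁻¹' F) := by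
    intro F
    rw [← goodStepEI_prodBernoulli_map_insert w s(v, x), map_measureReal_apply hmi (hmeas F)]
  have hadj : ∀ ω : BondConfig (Fin n), (openGraph (insert s(v, x) ω)).Reachable v x := fun ω =>
    SimpleGraph.Adj.reachable ((openGraph_adj _ v x).2 ⟨Set.mem_insert _ _, hvx⟩)
  have hU : (prodBernoulli (Function.update w s(v, x) 1)).real (⋃ a ∈ A, openConn v a) =
      (prodBernoulli (Function.update w s(v, x) 1)).real (⋃ a ∈ A, openConn x a) := by
    rw [htrans, htrans]
    congr 1
    ext ω
    simp only [Set.mem_preimage, Set.mem_iUnion, exists_prop]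
    constructor
    · rintro ⟨a, ha, h⟩
      exact ⟨a, ha, (hadj ω).symm.trans h⟩
    · rintro ⟨a, ha, h⟩
      exact ⟨a, ha, (hadj ω).trans h⟩
  have hB : (prodBernoulli (Function.update w s(v, x) 1)).real (openConn v b) =
      (prodBernoulli (Function.update w s(v, x) 1)).real (openConn x b) := by
    rw [htrans, htrans]
    congr 1
    ext ω
    exact ⟨fun h => (hadj ω).symm.trans h, fun h => (hadj ω).trans h⟩
  rw [hU, hB]
  exact h

end Summit.CriticalPhenomena.PercolationContinuityZ3.Theorems
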